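import Literature.Probability.Percolation.TwoSetConditionalAssociation
import HarnessLib

/-!
# Two-set avoidance probabilities are log-submodular ACROSS source and target
# (corollary of van den Berg–Häggström–Kahn 2006, Thm. 1.4/1.5 with vertex sets) — PROVED

Topic `Literature/Probability/Percolation`.  Bernoulli bond percolation with arbitrary edge probabilities
`w` on a finite vertex type (`μ = prodBernoulli w`); for vertex sets `S, X` write
`{S ↮ X} = {ω | ∀ s ∈ S, ∀ x ∈ X, s ↮ x}` ("no open path between `S` and `X`").

The tree already has, as printed by BHK (Remark (ii) after Thm. 3.2, p. 16, with Remark 1's sets),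
LOG-SUPERMODULARITY IN ONE ARGUMENT: `μ{S ↮ X} μ{S ↮ Y} ≤ μ{S ↮ X∩Y} μ{S ↮ X∪Y}`
(`BHK2006_setTwoSeparationSets.separationEvents`, `TwoSeparationSets.lean`).  This file records the
complementary MIXED inequality, in the opposite direction:

**Theorem (`separation_cross_mul_le`).**  For all vertex sets `S, S', X, X'`,
`μ{S ↮ X} · μ{S∪S' ↮ X∪X'} ≤ μ{S ↮ X∪X'} · μ{S∪S' ↮ X}`.

Equivalently (when `μ{S ↮ X} > 0`): `P(S∪S' ↮ X∪X' | S ↮ X) ≤ P(S ↮ X' | S ↮ X) · P(S' ↮ X | S ↮ X)`,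
or, as a monotonicity of conditional avoidance odds, `P(S' ↮ X∪X' | S ↮ X∪X') ≤ P(S' ↮ X | S ↮ X)`-type
statements: a LARGER avoided set makes it harder for additional sources to avoid it, a larger source set
makes it harder to avoid additional targets.  (No disjointness hypotheses: if `S ∪ S'` meets `X ∪ X'`
the left-hand side vanishes.)

PROOF (three lines on top of the tree).  Let `D = {S ↮ X}`, `A = {S ↔ X'}` (some vertex of `S` joined to
some vertex of `X'`; increasing, determined by `C_S = ⋃_{s∈S} C_s`) and `B = {X ↔ S'}` (increasing,
determined by `C_X`).  The set form of BHK's Theorem 1.4/1.5 [VandenbergHaggstromKahn2005, Thm. 1.5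
(p. 7), Thm. 2.1 (p. 9) at `q = 1`, Remark 1 (p. 5); tree `BHK2006_twoSetConditionalAssociation`] gives
`μ(D) μ(D∩A∩B) ≤ μ(D∩A) μ(D∩B)` (increasing events of the two clusters are negatively correlated given
`D`), which is equivalent to the same inequality for the complements `Aᶜ, Bᶜ` inside `D`; and
`D ∩ Aᶜ = {S ↮ X∪X'}`, `D ∩ Bᶜ = {S∪S' ↮ X}`, `D ∩ Aᶜ ∩ Bᶜ ⊇ {S∪S' ↮ X∪X'}`.  Not stated in print in
this form; all ingredients are BHK's.  No definition, no named fact.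

Context: this is the monotonicity of the "attachment odds"
`p_e P(S∪y ↮ X) / ((1−p_e) P(S ↮ X))` (decreasing in `X`, and — by `separationEvents` — increasing in `S`)
that drives the monotone coupling of BHK's two-cluster Gibbs sampler (their §2.1), used on the
percolation-near-one routes of `Summits/CriticalPhenomena/PercolationContinuityZ3` (crux `NoHeavyLowerTail`,
memo run/shared/lean/prim/prim-lit-3/LITERATURE-3.md §2U).

## References
* J. van den Berg, O. Häggström, J. Kahn, *Some conditional correlation inequalities for percolation and
  related processes*, Random Structures Algorithms 29 (2006) 417–435 (arXiv:math/0408176): Thm. 1.4/1.5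
  (p. 7), Thm. 2.1 (p. 9), Remark 1 after Thm. 1.2 (p. 5), Remark (ii) after Thm. 3.2 (p. 16).
  [VandenbergHaggstromKahn2005]
-/

noncomputable section

open MeasureTheory Set
open Literature.Probability.LatticeModels (prodBernoulli)

namespace Literature.Probability.Percolation

variable {V : Type*}

namespace SeparationCross

/-- `{S ↔ Y}` read off `C_S`: some vertex of `Y` is in `S` or on an edge of `C_S = ⋃_{s∈S} C_s` iff some
vertex of `S` is joined to some vertex of `Y`. [folklore] -/
theorem setOf_exists_reach (S Y : Set V) :
    {ω : BondConfig V | ∃ a ∈ Y, (a ∈ S ∨ ∃ e ∈ ⋃ s ∈ S, openEdgeCluster ω s, a ∈ e)} =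
      {ω | ∃ a ∈ Y, ∃ s ∈ S, (openGraph ω).Reachable s a} := by
  ext ω
  simp only [mem_setOf_eq]
  refine exists_congr fun a => and_congr_right fun _ => ?_
  have h := Set.ext_iff.1
    (TwoSetConditionalAssociation.setOf_mem_or_exists_mem_biUnion_openEdgeCluster S a) ω
  simp only [mem_setOf_eq, mem_iUnion, exists_prop, openConn] at h
  simpa only [mem_iUnion, exists_prop] using h

/-- The predicate `C ↦ ∃ a ∈ Y, a ∈ S ∨ ∃ e ∈ C, a ∈ e` is increasing in `C`. [folklore] -/
theorem reachPred_mono (S Y : Set V) :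
    ∀ ⦃C C' : Set (Sym2 V)⦄, C ⊆ C' →
      (∃ a ∈ Y, (a ∈ S ∨ ∃ e ∈ C, a ∈ e)) → (∃ a ∈ Y, (a ∈ S ∨ ∃ e ∈ C', a ∈ e)) :=
  fun _ _ h ⟨a, ha, h'⟩ => ⟨a, ha, h'.imp_right fun ⟨e, he, hae⟩ => ⟨e, h he, hae⟩⟩

end SeparationCross

open TripodExchange TwoSetConditionalAssociation SeparationCross in
/-- **Cross log-submodularity of two-set avoidance** (corollary of BHK 2006 Thm. 1.4/1.5 with vertex
sets): for Bernoulli bond percolation with arbitrary edge probabilities on a finite vertex type and all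
vertex sets `S, S', X, X'`,
`μ{S ↮ X} · μ{S∪S' ↮ X∪X'} ≤ μ{S ↮ X∪X'} · μ{S∪S' ↮ X}`.
[cite: VandenbergHaggstromKahn2005, Thm. 1.5 (p. 7) / Thm. 2.1 (p. 9) at q = 1 with Remark 1 (p. 5) — corollary, derived in this file] -/
theorem separation_cross_mul_le [Fintype V] (w : Sym2 V → unitInterval) (S S' X X' : Set V) :
    (prodBernoulli w).real {ω : BondConfig V | ∀ s ∈ S, ∀ x ∈ X, ¬ (openGraph ω).Reachable s x} *
        (prodBernoulli w).real
          {ω : BondConfig V | ∀ s ∈ S ∪ S', ∀ x ∈ X ∪ X', ¬ (openGraph ω).Reachable s x} ≤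
      (prodBernoulli w).real {ω : BondConfig V | ∀ s ∈ S, ∀ x ∈ X ∪ X', ¬ (openGraph ω).Reachable s x} *
        (prodBernoulli w).real
          {ω : BondConfig V | ∀ s ∈ S ∪ S', ∀ x ∈ X, ¬ (openGraph ω).Reachable s x} := by
  classical
  -- negative correlation given `D = {S ↮ X}` of `A = {S ↔ X'}` (increasing in `C_S`) and
  -- `B = {X ↔ S'}` (increasing in `C_X`): `μ(D) μ(D ∩ A ∩ B) ≤ μ(D ∩ A) μ(D ∩ B)`
  have key := BHK2006_twoSetConditionalAssociation w S X
    (fun C _ => if (∃ a ∈ X', (a ∈ S ∨ ∃ e ∈ C, a ∈ e)) then (1 : ℝ) else 0)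
    (fun _ E => -(if (∃ b ∈ S', (b ∈ X ∨ ∃ e ∈ E, b ∈ e)) then (1 : ℝ) else 0))
    (fun _ => predIndicator_monotone (reachPred_mono S X')) (fun _ => antitone_const)
    (fun _ => monotone_const) (fun _ => neg_predIndicator_antitone (reachPred_mono X S'))
  simp only [predIndicator_eq_indicator
      (fun ω => ∃ a ∈ X', (a ∈ S ∨ ∃ e ∈ ⋃ s ∈ S, openEdgeCluster ω s, a ∈ e)),
    predIndicator_eq_indicator
      (fun ω => ∃ b ∈ S', (b ∈ X ∨ ∃ e ∈ ⋃ t ∈ X, openEdgeCluster ω t, b ∈ e)),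
    integral_neg, mul_neg, neg_le_neg_iff] at key
  simp only [setIntegral_indicator_one_eq, setIntegral_indicator_mul_indicator_eq] at key
  rw [setOf_exists_reach S X', setOf_exists_reach X S'] at key
  -- names
  set μ := prodBernoulli w with hμ
  set D : Set (BondConfig V) := {ω | ∀ s ∈ S, ∀ x ∈ X, ¬ (openGraph ω).Reachable s x} with hD
  set A : Set (BondConfig V) := {ω | ∃ a ∈ X', ∃ s ∈ S, (openGraph ω).Reachable s a} with hA
  set B : Set (BondConfig V) := {ω | ∃ b ∈ S', ∃ t ∈ X, (openGraph ω).Reachable t b} with hB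
  -- `key : μ(D) * μ(D ∩ (A ∩ B)) ≤ μ(D ∩ A) * μ(D ∩ B)`
  have mA : MeasurableSet A := MeasurableSet.of_discrete
  have mB : MeasurableSet B := MeasurableSet.of_discrete
  -- complements inside `D`
  have hAc : μ.real (D ∩ A) + μ.real (D \ A) = μ.real D := measureReal_inter_add_sdiff mA
  have hBc : μ.real (D ∩ B) + μ.real (D \ B) = μ.real D := measureReal_inter_add_sdiff mB
  have hABc : μ.real ((D \ A) ∩ B) + μ.real ((D \ A) \ B) = μ.real (D \ A) :=
    measureReal_inter_add_sdiff mB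
  have hAB' : μ.real ((D ∩ B) ∩ A) + μ.real ((D ∩ B) \ A) = μ.real (D ∩ B) :=
    measureReal_inter_add_sdiff mA
  have e1 : (D ∩ B) ∩ A = D ∩ (A ∩ B) := by
    ext ω; simp only [mem_inter_iff]; tauto
  have e2 : (D ∩ B) \ A = (D \ A) ∩ B := by
    ext ω; simp only [mem_inter_iff, mem_sdiff]; tauto
  rw [e1] at hAB'
  rw [e2] at hAB'
  -- identify the complements with separation events
  have hDA : D \ A = {ω : BondConfig V | ∀ s ∈ S, ∀ x ∈ X ∪ X', ¬ (openGraph ω).Reachable s x} := by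
    ext ω
    simp only [hD, hA, mem_sdiff, mem_setOf_eq, mem_union, not_exists, not_and]
    constructor
    · rintro ⟨h1, h2⟩ s hs x (hx | hx)
      · exact h1 s hs x hx
      · exact fun h => h2 x hx s hs h
    · intro h
      exact ⟨fun s hs x hx => h s hs x (Or.inl hx), fun a ha s hs hsa => h s hs a (Or.inr ha) hsa⟩
  have hDB : D \ B = {ω : BondConfig V | ∀ s ∈ S ∪ S', ∀ x ∈ X, ¬ (openGraph ω).Reachable s x} := by
    ext ω
    simp only [hD, hB, mem_sdiff, mem_setOf_eq, mem_union, not_exists, not_and]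
    constructor
    · rintro ⟨h1, h2⟩ s (hs | hs) x hx
      · exact h1 s hs x hx
      · exact fun h => h2 s hs x hx h.symm
    · intro h
      exact ⟨fun s hs x hx => h s (Or.inl hs) x hx,
        fun b hb t ht htb => h b (Or.inr hb) t ht htb.symm⟩
  have hsub : {ω : BondConfig V | ∀ s ∈ S ∪ S', ∀ x ∈ X ∪ X', ¬ (openGraph ω).Reachable s x} ⊆
      (D \ A) \ B := by
    intro ω hω
    simp only [mem_setOf_eq, mem_union] at hω
    simp only [hD, hA, hB, mem_sdiff, mem_setOf_eq, not_exists, not_and]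
    exact ⟨⟨fun s hs x hx => hω s (Or.inl hs) x (Or.inl hx),
      fun a ha s hs hsa => hω s (Or.inl hs) a (Or.inr ha) hsa⟩,
      fun b hb t ht htb => hω b (Or.inr hb) t (Or.inl ht) htb.symm⟩
  have hmono : μ.real {ω : BondConfig V | ∀ s ∈ S ∪ S', ∀ x ∈ X ∪ X', ¬ (openGraph ω).Reachable s x} ≤
      μ.real ((D \ A) \ B) := measureReal_mono hsub
  rw [← hDA, ← hDB]
  -- arithmetic: with m = μ D, a = μ(D∩A), b = μ(D∩B), l = μ(D∩(A∩B)):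
  -- μ(D\A) = m - a, μ(D\B) = m - b, μ((D\A)\B) = m - a - b + l, and key : m l ≤ a b
  have hm0 : 0 ≤ μ.real D := measureReal_nonneg
  have h1 : μ.real D * μ.real ((D \ A) \ B) ≤ μ.real (D \ A) * μ.real (D \ B) := by
    have eA : μ.real (D \ A) = μ.real D - μ.real (D ∩ A) := by linarith
    have eB : μ.real (D \ B) = μ.real D - μ.real (D ∩ B) := by linarith
    have eAB : μ.real ((D \ A) \ B) =
        μ.real D - μ.real (D ∩ A) - μ.real (D ∩ B) + μ.real (D ∩ (A ∩ B)) := by linarith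
    rw [eA, eB, eAB]
    nlinarith [key, hm0]
  calc μ.real D * μ.real {ω : BondConfig V | ∀ s ∈ S ∪ S', ∀ x ∈ X ∪ X',
          ¬ (openGraph ω).Reachable s x}
        ≤ μ.real D * μ.real ((D \ A) \ B) := mul_le_mul_of_nonneg_left hmono hm0
    _ ≤ μ.real (D \ A) * μ.real (D \ B) := h1

open SeparationCross in
/-- **Corollary (the single-vertex attachment step).**  For a vertex `y` and sets `S, X ⊆ X'`-free form:
`μ{S ↮ X} · μ{S∪{y} ↮ X∪X'} ≤ μ{S ↮ X∪X'} · μ{S∪{y} ↮ X}` — "the odds that a fresh neighbour `y` may be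
attached to the source without touching the avoided set decrease when the avoided set grows".
[cite: VandenbergHaggstromKahn2005, Thm. 1.5 (p. 7) with Remark 1 (p. 5) — corollary, derived in this file] -/
theorem separation_cross_mul_le_insert [Fintype V] (w : Sym2 V → unitInterval) (S X X' : Set V)
    (y : V) :
    (prodBernoulli w).real {ω : BondConfig V | ∀ s ∈ S, ∀ x ∈ X, ¬ (openGraph ω).Reachable s x} *
        (prodBernoulli w).real
          {ω : BondConfig V | ∀ s ∈ S ∪ {y}, ∀ x ∈ X ∪ X', ¬ (openGraph ω).Reachable s x} ≤
      (prodBernoulli w).real {ω : BondConfig V | ∀ s ∈ S, ∀ x ∈ X ∪ X', ¬ (openGraph ω).Reachable s x} *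
        (prodBernoulli w).real
          {ω : BondConfig V | ∀ s ∈ S ∪ {y}, ∀ x ∈ X, ¬ (openGraph ω).Reachable s x} :=
  separation_cross_mul_le w S {y} X X'

end Literature.Probability.Percolation

end
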